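import Summits.ResolutionOfSingularities.ResolutionOfSingularities.Theorems.FrobeniusClosingSteerNoSatelliteStep
import Summits.ResolutionOfSingularities.ResolutionOfSingularities.Theorems.FrobeniusClosingSteerNestedCohenFrames
import HarnessLib

/-!
# Crux `Steer` (stmt-ResolutionOfSingularities-16345), chain W4.1, hGW3 WORK-MODULO: Lemma S_λ up to (N) — the ODD-SUPPORT READING of a SATELLITE window
# WITHOUT perfectness of the residue fields (nested Cohen frames)

OURS (campaign `res-hironaka`, rung L ★L-G4, slot W4.1; seat res-L0-w41-stub-2 g6; `hGW3-ASSEMBLY-MAP.md` d0970ee959ebaf4a §2 (S_λ); replaces the role of no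
printed item; NOT a statement of the manuscript under review [claim: Hironaka2017, status: under-review]; AI-produced). Theses-free, definition-free.

The Lemma S kernel `NoSatelliteStep.span_excParam_eq_of_rational` (p549989) uses the perfectness of `κ(S₀)` at exactly two places — the finite-level chart square
(res-D-pv-007 (Tsq)) and realisability (R) — and the perfectness of `κ(Ŝ₁)` at (N). Here (Tsq)/(R) are replaced by `NestedFrames.exists_nested_frames_of_section`
(coefficient fields NESTED along `S₀ → S₁ → S₂`, both charts read EXACTLY as monomial substitutions), so that everything up to (N) holds for ANY residue field:

* `NoSatelliteNested.map_substGenerators` — coefficient maps commute with monomial substitutions (injective exponent map);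
* `NoSatelliteNested.prod_pow_chart` — the chart monomials `∏ⱼ vⱼ^{(X^{g i})ⱼ}` at a letter `a` with weight `1`;
* `NoSatelliteNested.exists_frame_odd_support_of_satellite` — **(W)+(F_λ)+(α)(β)(γ)+(Σ)**: for a window `S₀ ≤ S₁ ≤ S₂ ≤ S₃` (regular, dimension `m + 2`,
  quadratic transforms, laws of exponent `2e ≥ 4`, RATIONAL centres at `S₁` and `S₂`, NO perfectness) whose second step is a SATELLITE, there are a unit `u₀`,
  a coefficient field `σ₁` of `Ŝ₁` and a Cohen frame `φ₁` adapted to it such that `F := φ₁(u₀^(2e) f₁)` has the ODD-SUPPORT property off the letter `y`: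
  every monomial of `F` with an odd exponent has total degree `≥ 2` in the letters `≠ y`.
What remains for S_λ (imperfect `κ`): (N_λ) «odd support off `y` in every `λ`-component ⟹ not isolated» (K-GG1/K-GG3, res-L0-w41-stub-3) + descent
`not_hasIsolatedSingularity_of_ringEquiv_adicCompletion` + `RadicandRescale.isolated_unit_pow_mul`, exactly as in the perfect kernel. [folklore]
-/

noncomputable section

set_option linter.dupNamespace false

open IsLocalRing MvPowerSeries
open Literature.AlgebraicGeometry.Resolution Literature.RingTheory.MvPowerSeries Literature.RingTheory.MvPowerSeries.monoidPowerSeries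
open Summit.ResolutionOfSingularities.ResolutionOfSingularities.Theorems.SwitchingDichotomy
open Summit.ResolutionOfSingularities.ResolutionOfSingularities.Theorems.SwitchingDichotomy.ChartMonomialSubst

namespace Summit.ResolutionOfSingularities.ResolutionOfSingularities.Theorems.SwitchingDichotomy.NoSatelliteNested

/-! ## Small algebra -/

/-- **Coefficient maps commute with monomial substitutions** (injective exponent map): `ρ_* (F(X^g)) = (ρ_* F)(X^g)`. -/
theorem map_substGenerators {R R' : Type} [CommRing R] [CommRing R'] (ρ : R →+* R') {σ ι : Type} [Finite ι]
    (g : ι → (σ →₀ ℕ)) (hg0 : ∀ i, g i ≠ 0) (hinj : Function.Injective (expSum g)) (F : MvPowerSeries ι R) :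
    MvPowerSeries.map ρ (substGenerators (R := R) g hg0 F) = substGenerators (R := R') g hg0 (MvPowerSeries.map ρ F) := by
  ext e
  rw [coeff_map]
  by_cases h : ∃ d, expSum g d = e
  · obtain ⟨d, rfl⟩ := h
    rw [coeff_substGenerators_expSum g hg0 hinj, coeff_substGenerators_expSum g hg0 hinj, coeff_map]
  · simp only [not_exists] at h
    rw [coeff_substGenerators_eq_zero_of_forall_ne g hg0 F h, coeff_substGenerators_eq_zero_of_forall_ne g hg0 _ h, map_zero]

/-- The chart monomial at the letter `a` with weight `1`: `∏ⱼ vⱼ ^ (single i 1 + [i ≠ a]·single a 1)ⱼ = v a` for `i = a`, `v i · v a` otherwise. -/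
theorem prod_pow_chart {R : Type} [CommMonoid R] {n : ℕ} (v : Fin n → R) (a i : Fin n) :
    ∏ j, v j ^ ((Finsupp.single i 1 + if i = a then 0 else (1 : ℕ) • Finsupp.single a 1 : Fin n →₀ ℕ) j) =
      if i = a then v a else v i * v a := by
  classical
  have hsingle : ∀ (k : Fin n) (N : ℕ), ∏ j, v j ^ ((Finsupp.single k N : Fin n →₀ ℕ) j) = v k ^ N := by
    intro k N
    rw [Finset.prod_eq_single k (fun j _ hj => by rw [Finsupp.single_apply, if_neg (Ne.symm hj), pow_zero])
      (fun h => absurd (Finset.mem_univ k) h), Finsupp.single_eq_same]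
  simp_rw [Finsupp.add_apply, pow_add, Finset.prod_mul_distrib, hsingle, pow_one]
  split_ifs with hi
  · simp_rw [Finsupp.coe_zero, Pi.zero_apply, pow_zero, Finset.prod_const_one, mul_one]
    rw [hi]
  · rw [one_smul, hsingle, pow_one]

/-! ## The odd-support reading of a satellite window, any residue field -/

variable {L : Type} [Field L] [CharP L 2]

/-- **Lemma S_λ up to (N).** A window `S₀ ≤ S₁ ≤ S₂ ≤ S₃ ⊂ L` of quadratic transforms of regular local subrings of dimension `m + 2` in characteristic `2`,
laws `f_{i+1} x_i^(2e) = f_i − g_i²` with `2e ≥ 4`, RATIONAL centres at `S₁` and at `S₂`, and a SATELLITE second step `(x₀) ≠ (x₁)` in `S₂`: then for a unit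
`u₀ ∈ S₁`, a coefficient field `σ₁` of `Ŝ₁` and a Cohen frame `φ₁ : Ŝ₁ ≃ κ(Ŝ₁)⟦X_0..X_{m+1}⟧` adapted to `σ₁` (reading residues as constant terms), the series
`F := φ₁(u₀^(2e)·f₁)` has ODD SUPPORT OFF THE LETTER `1`: `coeff_d F ≠ 0`, some `d i` odd ⟹ `2 ≤ Σ_{t ≠ 1} d t`. No perfectness anywhere. [folklore] -/
theorem exists_frame_odd_support_of_satellite {m e : ℕ} (he : 2 ≤ e)
    {S₀ S₁ S₂ S₃ : Subring L} [IsLocalRing S₀] [IsLocalRing S₁] [IsLocalRing S₂] [IsLocalRing S₃]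
    (h₀₁ : S₀ ≤ S₁) (h₁₂ : S₁ ≤ S₂) (h₂₃ : S₂ ≤ S₃)
    (hreg₀ : IsRegularLocalRing S₀) (hreg₁ : IsRegularLocalRing S₁) (hreg₂ : IsRegularLocalRing S₂)
    (hdim₀ : ringKrullDim S₀ = (m + 2 : ℕ)) (hdim₁ : ringKrullDim S₁ = (m + 2 : ℕ)) (hdim₂ : ringKrullDim S₂ = (m + 2 : ℕ))
    (hqt₀ : IsQuadraticTransform S₀ S₁) (hqt₁ : IsQuadraticTransform S₁ S₂) (hqt₂ : IsQuadraticTransform S₂ S₃)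
    (f₀ g₀ : S₀) (f₁ g₁ : S₁) (f₂ g₂ : S₂) (f₃ : S₃) (x₀ : S₁) (x₁ : S₂) (x₂ : S₃)
    (hx₀ : (maximalIdeal S₀).map (Subring.inclusion h₀₁) = Ideal.span {x₀})
    (hx₁ : (maximalIdeal S₁).map (Subring.inclusion h₁₂) = Ideal.span {x₁})
    (hx₂ : (maximalIdeal S₂).map (Subring.inclusion h₂₃) = Ideal.span {x₂})
    (hlaw₀ : ((f₁ : S₁) : L) * ((x₀ : S₁) : L) ^ (2 * e) = ((f₀ : S₀) : L) - ((g₀ : S₀) : L) ^ 2)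
    (hlaw₁ : ((f₂ : S₂) : L) * ((x₁ : S₂) : L) ^ (2 * e) = ((f₁ : S₁) : L) - ((g₁ : S₁) : L) ^ 2)
    (hlaw₂ : ((f₃ : S₃) : L) * ((x₂ : S₃) : L) ^ (2 * e) = ((f₂ : S₂) : L) - ((g₂ : S₂) : L) ^ 2)
    (hrat₀ : ∀ z : S₁, ∃ s : S₀, z - Subring.inclusion h₀₁ s ∈ maximalIdeal S₁)
    (hrat₁ : ∀ z : S₂, ∃ s : S₁, z - Subring.inclusion h₁₂ s ∈ maximalIdeal S₂)
    (hsat : Ideal.span {Subring.inclusion h₁₂ x₀} ≠ Ideal.span {x₁}) :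
    ∃ (u₀ : S₁) (σ₁ : ResidueField (AdicCompletion (maximalIdeal S₁) S₁) →+* AdicCompletion (maximalIdeal S₁) S₁)
      (φ₁ : AdicCompletion (maximalIdeal S₁) S₁ ≃+* MvPowerSeries (Fin (m + 2)) (ResidueField (AdicCompletion (maximalIdeal S₁) S₁))),
      IsUnit u₀ ∧ (∀ c, residue _ (σ₁ c) = c) ∧ (∀ c, φ₁ (σ₁ c) = C c) ∧ (∀ a, constantCoeff (φ₁ a) = residue _ a) ∧
      ∀ d : Fin (m + 2) →₀ ℕ, (∃ i, Odd (d i)) → coeff d (φ₁ (algebraMap S₁ _ (u₀ ^ (2 * e) * f₁))) ≠ 0 →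
        2 ≤ ∑ t ∈ (Finset.univ : Finset (Fin (m + 2))).erase 1, d t := by
  classical
  haveI : Fact (Nat.Prime 2) := ⟨Nat.prime_two⟩
  haveI := hreg₀
  haveI := hreg₁
  haveI := hreg₂
  have hdom₀ : SubringDominates S₀ S₁ := hqt₀.dominates
  have hdom₁ : SubringDominates S₁ S₂ := hqt₁.dominates
  -- ### (W) window coordinates
  obtain ⟨X, Y, Yk, y, z, x', w, u₀, v, hu₀, hv, hx₀u, hx₁v, hgen₀, hgen₁, hgen₂, hY, hYk, hXrel, hzrel⟩ :=
    NoSatelliteWindow.exists_window h₀₁ h₁₂ hreg₀ hdim₀ hqt₀ hqt₁ x₀ x₁ hx₀ hx₁ hrat₀ hrat₁ hsat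
  -- ### (F_λ) nested frames along `S₀ → S₁ → S₂`
  have hφ₀ : (maximalIdeal S₀).map (Subring.inclusion h₀₁) ≤ maximalIdeal S₁ :=
    Ideal.map_le_iff_le_comap.mpr fun s hs => FreeChain.inclusion_mem_maximalIdeal hdom₀ hs
  have hφ₁ : (maximalIdeal S₁).map (Subring.inclusion h₁₂) ≤ maximalIdeal S₂ :=
    Ideal.map_le_iff_le_comap.mpr fun s hs => FreeChain.inclusion_mem_maximalIdeal hdom₁ hs
  obtain ⟨σ₀, frame₀, hσ₀, hf0x, hf0σ, -⟩ := NestedFrames.exists_frame_with_section 2 hdim₀ (Fin.cons X (Fin.cons Y Yk)) hgen₀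
  obtain ⟨φ₁, ρ₀, σ₁, hσ₁, hf1x, hf1σ, hf1res, -, hsq₀⟩ := NestedFrames.exists_nested_frames_of_section 2 (Subring.inclusion h₀₁) hφ₀ hrat₀ hdim₁
    (Fin.cons X (Fin.cons Y Yk)) hgen₀ (Fin.cons (Subring.inclusion h₀₁ X) (Fin.cons y z)) hgen₁
    (fun i : Fin (m + 2) => Finsupp.single i 1 + if i = 0 then 0 else 1 • Finsupp.single 0 1) (chartExp_ne_zero 0 1)
    (fun i => by
      rw [prod_pow_chart]
      refine Fin.cases ?_ (fun i => Fin.cases ?_ (fun k => ?_) i) i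
      · rw [if_pos rfl, Fin.cons_zero, Fin.cons_zero]
      · rw [Fin.succ_zero_eq_one, if_neg Fin.zero_ne_one.symm, Fin.cons_one, Fin.cons_zero, Fin.cons_one, Fin.cons_zero, Fin.cons_zero, hY, mul_comm]
      · rw [if_neg (Fin.succ_ne_zero _), Fin.cons_succ, Fin.cons_succ, Fin.cons_succ, Fin.cons_succ, Fin.cons_zero, hYk, mul_comm])
    σ₀ hσ₀ frame₀ hf0x hf0σ
  obtain ⟨φ₂, ρ₁, σ₂, -, hf2x, -, -, -, hsq₁⟩ := NestedFrames.exists_nested_frames_of_section 2 (Subring.inclusion h₁₂) hφ₁ hrat₁ hdim₂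
    (Fin.cons (Subring.inclusion h₀₁ X) (Fin.cons y z)) hgen₁ (Fin.cons x' (Fin.cons (Subring.inclusion h₁₂ y) w)) hgen₂
    (fun i : Fin (m + 2) => Finsupp.single i 1 + if i = 1 then 0 else 1 • Finsupp.single 1 1) (chartExp_ne_zero 1 1)
    (fun i => by
      rw [prod_pow_chart]
      refine Fin.cases ?_ (fun i => Fin.cases ?_ (fun k => ?_) i) i
      · rw [if_neg Fin.zero_ne_one, Fin.cons_zero, Fin.cons_zero, Fin.cons_one, Fin.cons_zero]; exact hXrel
      · rw [Fin.succ_zero_eq_one, if_pos rfl, Fin.cons_one, Fin.cons_zero, Fin.cons_one, Fin.cons_zero]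
      · rw [if_neg (Fin.succ_succ_ne_one k), Fin.cons_succ, Fin.cons_succ, Fin.cons_succ, Fin.cons_succ, Fin.cons_one, Fin.cons_zero]; exact hzrel k)
    σ₁ hσ₁ φ₁ hf1x hf1σ
  -- ### the two readings as ring homs `S₁ → κ(Ŝ₁)⟦X⟧`, `S₂ → κ(Ŝ₂)⟦X⟧`
  set E₁ : S₁ →+* MvPowerSeries (Fin (m + 2)) (ResidueField (AdicCompletion (maximalIdeal S₁) S₁)) :=
    φ₁.toRingHom.comp (algebraMap S₁ (AdicCompletion (maximalIdeal S₁) S₁)) with hE₁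
  set E₂ : S₂ →+* MvPowerSeries (Fin (m + 2)) (ResidueField (AdicCompletion (maximalIdeal S₂) S₂)) :=
    φ₂.toRingHom.comp (algebraMap S₂ (AdicCompletion (maximalIdeal S₂) S₂)) with hE₂
  have hE₁x : ∀ i, E₁ ((Fin.cons (Subring.inclusion h₀₁ X) (Fin.cons y z) : Fin (m + 2) → S₁) i) = MvPowerSeries.X i := fun i => by
    rw [hE₁, RingHom.comp_apply, RingEquiv.toRingHom_eq_coe, RingHom.coe_coe, hf1x]
  have hE₂x : ∀ i, E₂ ((Fin.cons x' (Fin.cons (Subring.inclusion h₁₂ y) w) : Fin (m + 2) → S₂) i) = MvPowerSeries.X i := fun i => by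
    rw [hE₂, RingHom.comp_apply, RingEquiv.toRingHom_eq_coe, RingHom.coe_coe, hf2x]
  have hinj₀ := expSum_chart_injective (σ := Fin (m + 2)) 0 1
  have hreal : ∀ s : S₀, ∃ H : MvPowerSeries (Fin (m + 2)) (ResidueField (AdicCompletion (maximalIdeal S₁) S₁)),
      substGenerators (R := ResidueField (AdicCompletion (maximalIdeal S₁) S₁))
        (fun i : Fin (m + 2) => Finsupp.single i 1 + if i = 0 then 0 else 1 • Finsupp.single 0 1) (chartExp_ne_zero 0 1) H =
        E₁ (Subring.inclusion h₀₁ s) := fun s =>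
    ⟨MvPowerSeries.map (ρ₀ : _ →+* _) (frame₀ (algebraMap S₀ _ s)), by
      rw [hE₁, RingHom.comp_apply, RingEquiv.toRingHom_eq_coe, RingHom.coe_coe, hsq₀, map_substGenerators _ _ _ hinj₀]⟩
  have hsq : ∀ s : S₁, E₂ (Subring.inclusion h₁₂ s) = MvPowerSeries.map (ρ₁ : _ →+* _)
      (substGenerators (R := ResidueField (AdicCompletion (maximalIdeal S₁) S₁))
        (fun i : Fin (m + 2) => Finsupp.single i 1 + if i = 1 then 0 else 1 • Finsupp.single 1 1) (chartExp_ne_zero 1 1) (E₁ s)) := fun s => by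
    rw [hE₂, RingHom.comp_apply, RingEquiv.toRingHom_eq_coe, RingHom.coe_coe, hsq₁, hE₁, RingHom.comp_apply, RingEquiv.toRingHom_eq_coe,
      RingHom.coe_coe]
  -- ### (α)(β)(γ) readings (κ-free lemmas of the perfect kernel) and (Σ)
  have hA1₁ := CleaningOptimal.sub_pow_mem_pow_of_law 2 hreg₁ hqt₁ h₁₂ f₁ g₁ f₂ x₁ e hx₁ hlaw₁
  have hA1₂ := CleaningOptimal.sub_pow_mem_pow_of_law 2 hreg₂ hqt₂ h₂₃ f₂ g₂ f₃ x₂ e hx₂ hlaw₂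
  obtain ⟨⟨H, hα⟩, hβ⟩ := NoSatelliteStep.reading_alpha_beta h₀₁ E₁ _ hgen₁ hE₁x X (Fin.cons_zero _ _) hreal f₀ g₀ f₁ g₁ x₀ u₀ hx₀u hlaw₀ hA1₁
  obtain ⟨A, R, hR, hγ⟩ := NoSatelliteStep.reading_gamma h₁₂ E₂ _ hgen₂ hE₂x y (by rw [Fin.cons_one, Fin.cons_zero]) f₁ g₁ u₀ f₂ g₂ x₁ v hx₁v hlaw₁ hA1₂
  rw [hsq] at hγ
  haveI : CharP (AdicCompletion (maximalIdeal S₁) S₁) 2 := RadicandCohenFrame.charP_adicCompletion 2 S₁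
  haveI : CharP (ResidueField (AdicCompletion (maximalIdeal S₁) S₁)) 2 := RadicandCohenFrame.charP_residueField 2
  haveI : CharP (AdicCompletion (maximalIdeal S₂) S₂) 2 := RadicandCohenFrame.charP_adicCompletion 2 S₂
  haveI : CharP (ResidueField (AdicCompletion (maximalIdeal S₂) S₂)) 2 := RadicandCohenFrame.charP_residueField 2
  have hsupp := NoSatelliteSupport.odd_support_of_window (by omega : 4 ≤ 2 * e) (ρ₁ : _ →+* _) hα hβ hR hγ
  refine ⟨u₀, σ₁, φ₁, hu₀, hσ₁, hf1σ, hf1res, fun d hodd hne => hsupp d hodd ?_⟩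
  rwa [hE₁, RingHom.comp_apply, RingEquiv.toRingHom_eq_coe, RingHom.coe_coe]

end Summit.ResolutionOfSingularities.ResolutionOfSingularities.Theorems.SwitchingDichotomy.NoSatelliteNested

end
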